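import Mathlib
import Summits.CriticalPhenomena.PercolationContinuityZ3.Theorems.PercNearOneGluingNoHeavyLowerTailSahiCombTriWTiltCert

/-!
# The TROPICAL (initial-matrix) principle for one-parameter monomial certificates, and its instance for the tilt certificate `T(x)`

Support file of the one-cut programme (crux `NoHeavyLowerTail`, stmt-CriticalPhenomena-4575; lemma factory `prim-lf-1`, gen 33;
memo `FROM-prim-lf-1-gen33-TROPICAL-AND-GENERIC-BLOCKS.md`; the principle is P5 gen 19's "tropical principle", memo
`FROM-prim-masterthm-p5-g19-QZETA-CHANNELS.md` §4(a), whose formalisation was requested there in §7(3)).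

Setting.  A ONE-PARAMETER MONOMIAL MATRIX FAMILY on finite index types `R` (rows) and `C` (columns):
`monoMat c w x r k = c r k * x ^ (w r k)` with rational coefficients `c` and natural exponents `w`.  POTENTIALS are integer weights
`φ : R → ℤ`, `ψ : C → ℤ` with `φ r + ψ k ≤ w r k` wherever `c r k ≠ 0` (dual feasibility for the exponents); the INITIAL MATRIX keeps the
coefficients on the TIGHT entries `φ r + ψ k = w r k` and is `0` elsewhere (`initMat`).

* **`linearIndependent_monoMat_of_initMat`** — if the rows of the initial matrix are linearly independent over `ℚ`, then the rows of
  `monoMat c w x` are linearly independent for ALL BUT FINITELY MANY `x : ℚ` (in particular for some `x`, `exists_linearIndependent_monoMat`).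
  Proof: rescale rows by `x^{-φ}` and columns by `x^{-ψ}` — over `ℚ[X]` this is the polynomial matrix `C(c)·X^{w-φ-ψ}` whose value at `X = 0`
  is the initial matrix; the GRAM determinant `det(M Mᵀ)` of that polynomial matrix is a polynomial whose value at `0` is the Gram determinant
  of the initial matrix, non-zero because its rows are independent (`gram_det_ne_zero_of_linearIndependent`, a sum-of-squares argument over
  the ordered field `ℚ`); so it has finitely many roots, and off the roots (and off `x = 0`) the rescaled matrix — hence `monoMat c w x`, which
  differs from it by invertible diagonal scalings — has independent rows (`linearIndependent_of_gram_det_ne_zero`).  No maximal minor is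
  ever chosen.
* **`tiltCert_eq_monoMat`** — the tilt certificate `T(x)` of `…SahiCombTriWTiltCert` IS such a family: coefficient `tiltCoef r c ∈ {0,1}`
  (the 339 sparsity on the containment relation) and exponent `tiltExp r c` (`= #(w\v)+#(u\d)` on the two tilted blocks, `0` elsewhere).
* **`TiltInitIndep`** (a definition, NOT asserted): "every configuration admits potentials whose initial matrix has independent demand rows";
  **`tiltCertIndep_of_tiltInitIndep : TiltInitIndep → TiltCertIndep`** — so any per-configuration RULE producing feasible potentials with a
  provably independent (e.g. triangular / antipodal-basis) initial 0/1 pattern proves `TiltCertIndep`, hence `TriWIneq` for every `a`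
  (`triWIneq_of_tiltCertIndep`).  Census (P5 g19 §4(b), lf-1 g33): optimal min-cost-flow potentials certify every configuration tested at
  `m ≤ 4` and 399/400 sampled at `m = 5`; NO uniform potential rule is known — `TiltInitIndep` is recorded as the q-free form of the open
  problem, not as a fact.
HONEST LABEL: three proved lemmas of linear algebra, one identification, one definition and one proved reduction; `TiltCertIndep` and
`TriWIneq` remain OPEN. [this work]
-/

namespace Summit.CriticalPhenomena.PercolationContinuityZ3.Theorems

namespace FiveUpSet

open Finset Matrix Polynomial

section Tropical

variable {R C : Type} [Fintype R] [Fintype C] [DecidableEq R] [DecidableEq C]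

/-! ### Gram determinants over `ℚ` -/

omit [DecidableEq C] in
/-- Rows of a rational matrix are linearly independent ⟹ its Gram matrix `A * Aᵀ` has non-zero determinant
(if `v (A Aᵀ) = 0` then `‖v A‖² = 0`, so `v A = 0`). [folklore] -/
theorem gram_det_ne_zero_of_linearIndependent (A : Matrix R C ℚ) (h : LinearIndependent ℚ (fun r => A r)) :
    (A * Aᵀ).det ≠ 0 := by
  intro hdet
  obtain ⟨v, hv, hvA⟩ := Matrix.exists_vecMul_eq_zero_iff.2 hdet
  have hinj : Function.Injective A.vecMul := Matrix.vecMul_injective_iff.2 h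
  have hu : (v ᵥ* A) ⬝ᵥ (v ᵥ* A) = 0 := by
    have h1 : v ⬝ᵥ ((A * Aᵀ) *ᵥ v) = 0 := by
      have h2 : (A * Aᵀ) *ᵥ v = v ᵥ* (A * Aᵀ) := by
        rw [← Matrix.vecMul_transpose, Matrix.transpose_mul, Matrix.transpose_transpose]
      rw [h2, hvA, dotProduct_zero]
    rwa [← Matrix.mulVec_mulVec, Matrix.dotProduct_mulVec, Matrix.mulVec_transpose] at h1
  have hzero : v ᵥ* A = 0 := dotProduct_self_eq_zero.1 hu
  exact hv (hinj (show v ᵥ* A = (0 : R → ℚ) ᵥ* A by rw [hzero, Matrix.zero_vecMul]))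

omit [DecidableEq C] in
/-- Conversely, a non-zero Gram determinant forces independent rows. [folklore] -/
theorem linearIndependent_of_gram_det_ne_zero (A : Matrix R C ℚ) (h : (A * Aᵀ).det ≠ 0) :
    LinearIndependent ℚ (fun r => A r) := by
  have hunit : IsUnit (A * Aᵀ) := (Matrix.isUnit_iff_isUnit_det _).2 (isUnit_iff_ne_zero.2 h)
  have hinjG : Function.Injective (A * Aᵀ).vecMul := Matrix.vecMul_injective_iff_isUnit.2 hunit
  have hinj : Function.Injective A.vecMul := by
    intro v₁ v₂ hv
    apply hinjG
    change v₁ ᵥ* (A * Aᵀ) = v₂ ᵥ* (A * Aᵀ)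
    rw [← Matrix.vecMul_vecMul, ← Matrix.vecMul_vecMul]
    exact congrArg (fun u => u ᵥ* Aᵀ) hv
  exact Matrix.vecMul_injective_iff.1 hinj

/-! ### Monomial families, potentials, initial matrices -/

/-- The one-parameter monomial matrix family `x ↦ (c r k · x ^ (w r k))`. [this work] -/
def monoMat (c : R → C → ℚ) (w : R → C → ℕ) (x : ℚ) : Matrix R C ℚ := fun r k => c r k * x ^ (w r k)

/-- The INITIAL MATRIX of the family w.r.t. potentials `φ, ψ`: the coefficient on tight entries `φ r + ψ k = w r k`, else `0`. [this work] -/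
def initMat (c : R → C → ℚ) (w : R → C → ℕ) (φ : R → ℤ) (ψ : C → ℤ) : Matrix R C ℚ :=
  fun r k => if φ r + ψ k = (w r k : ℤ) then c r k else 0

/-- The rescaled family as a matrix over `ℚ[X]`: `C(c r k) · X ^ (w r k − φ r − ψ k)` on the feasible entries `φ r + ψ k ≤ w r k`, else `0`. [this work] -/
noncomputable def scaledPolyMat (c : R → C → ℚ) (w : R → C → ℕ) (φ : R → ℤ) (ψ : C → ℤ) : Matrix R C ℚ[X] :=
  fun r k => if φ r + ψ k ≤ (w r k : ℤ) then Polynomial.C (c r k) * X ^ ((w r k : ℤ) - φ r - ψ k).toNat else 0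

omit [Fintype R] [Fintype C] [DecidableEq R] [DecidableEq C] in
/-- Evaluating the rescaled polynomial matrix at `x`. [this work] -/
theorem scaledPolyMat_map_eval (c : R → C → ℚ) (w : R → C → ℕ) (φ : R → ℤ) (ψ : C → ℤ) (x : ℚ) (r : R) (k : C) :
    (scaledPolyMat c w φ ψ).map (Polynomial.evalRingHom x) r k
      = if φ r + ψ k ≤ (w r k : ℤ) then c r k * x ^ ((w r k : ℤ) - φ r - ψ k).toNat else 0 := by
  simp only [Matrix.map_apply, scaledPolyMat]
  split_ifs with hle
  · simp [Polynomial.eval_mul, Polynomial.eval_pow]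
  · simp

omit [Fintype R] [Fintype C] [DecidableEq R] [DecidableEq C] in
/-- At `x = 0` the rescaled matrix is the initial matrix (given dual feasibility of the potentials). [this work] -/
theorem scaledPolyMat_map_eval_zero (c : R → C → ℚ) (w : R → C → ℕ) (φ : R → ℤ) (ψ : C → ℤ) :
    (scaledPolyMat c w φ ψ).map (Polynomial.evalRingHom 0) = initMat c w φ ψ := by
  ext r k
  rw [scaledPolyMat_map_eval]
  unfold initMat
  by_cases heq : φ r + ψ k = (w r k : ℤ)
  · have hle : φ r + ψ k ≤ (w r k : ℤ) := heq.le
    rw [if_pos hle, if_pos heq]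
    have h0 : ((w r k : ℤ) - φ r - ψ k).toNat = 0 := by omega
    rw [h0, pow_zero, mul_one]
  · rw [if_neg heq]
    by_cases hle : φ r + ψ k ≤ (w r k : ℤ)
    · rw [if_pos hle]
      have hpos : ((w r k : ℤ) - φ r - ψ k).toNat ≠ 0 := by omega
      rw [zero_pow hpos, mul_zero]
    · rw [if_neg hle]

omit [Fintype R] [Fintype C] [DecidableEq R] [DecidableEq C] in
/-- For `x ≠ 0` the monomial matrix is the rescaled matrix conjugated by the diagonal scalings `x^φ`, `x^ψ`
(entrywise; needs dual feasibility on the support). [this work] -/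
theorem monoMat_eq_scaled (c : R → C → ℚ) (w : R → C → ℕ) (φ : R → ℤ) (ψ : C → ℤ)
    (hpot : ∀ r k, c r k ≠ 0 → φ r + ψ k ≤ (w r k : ℤ)) {x : ℚ} (hx : x ≠ 0) (r : R) (k : C) :
    monoMat c w x r k = x ^ (φ r) * (scaledPolyMat c w φ ψ).map (Polynomial.evalRingHom x) r k * x ^ (ψ k) := by
  rw [scaledPolyMat_map_eval]
  unfold monoMat
  by_cases hc : c r k = 0
  · rw [hc]; simp
  · rw [if_pos (hpot r k hc)]
    have hnat : (((w r k : ℤ) - φ r - ψ k).toNat : ℤ) = (w r k : ℤ) - φ r - ψ k := by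
      have := hpot r k hc; omega
    have key : x ^ (φ r) * x ^ ((w r k : ℤ) - φ r - ψ k).toNat * x ^ (ψ k) = x ^ (w r k) := by
      rw [← zpow_natCast x ((w r k : ℤ) - φ r - ψ k).toNat, hnat, ← zpow_add₀ hx, ← zpow_add₀ hx, ← zpow_natCast]
      congr 1; ring
    calc c r k * x ^ w r k = c r k * (x ^ (φ r) * x ^ ((w r k : ℤ) - φ r - ψ k).toNat * x ^ (ψ k)) := by rw [key]
      _ = x ^ φ r * (c r k * x ^ ((w r k : ℤ) - φ r - ψ k).toNat) * x ^ ψ k := by ring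

omit [DecidableEq C] in
/-- **THE TROPICAL (INITIAL-MATRIX) PRINCIPLE.**  If potentials `φ, ψ` are dual-feasible for the exponents on the support of `c` and the
initial matrix has linearly independent rows, then the rows of `monoMat c w x` are linearly independent for all `x` outside a finite set. [this work] -/
theorem linearIndependent_monoMat_of_initMat (c : R → C → ℚ) (w : R → C → ℕ) (φ : R → ℤ) (ψ : C → ℤ)
    (hpot : ∀ r k, c r k ≠ 0 → φ r + ψ k ≤ (w r k : ℤ))
    (hI : LinearIndependent ℚ (fun r => initMat c w φ ψ r)) :
    ∃ s : Finset ℚ, ∀ x, x ∉ s → LinearIndependent ℚ (fun r => monoMat c w x r) := by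
  classical
  set Mp := scaledPolyMat c w φ ψ with hMp
  set p : ℚ[X] := (Mp * Mpᵀ).det with hp
  -- evaluation of p at x is the Gram determinant of the evaluated matrix
  have heval : ∀ x : ℚ, p.eval x
      = (Mp.map (Polynomial.evalRingHom x) * (Mp.map (Polynomial.evalRingHom x))ᵀ).det := by
    intro x
    have h1 : (Polynomial.evalRingHom x) p = ((Polynomial.evalRingHom x).mapMatrix (Mp * Mpᵀ)).det :=
      RingHom.map_det (Polynomial.evalRingHom x) (Mp * Mpᵀ)
    rw [Polynomial.coe_evalRingHom] at h1
    rw [h1, RingHom.mapMatrix_apply, Matrix.map_mul, Matrix.transpose_map]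
  -- p(0) ≠ 0, hence p ≠ 0
  have hp0 : p.eval 0 ≠ 0 := by
    rw [heval 0, scaledPolyMat_map_eval_zero]
    exact gram_det_ne_zero_of_linearIndependent _ hI
  have hpne : p ≠ 0 := fun h => hp0 (by rw [h, Polynomial.eval_zero])
  refine ⟨p.roots.toFinset ∪ {0}, fun x hx => ?_⟩
  rw [Finset.mem_union, Finset.mem_singleton, Multiset.mem_toFinset, not_or] at hx
  obtain ⟨hroot, hx0⟩ := hx
  have hpx : p.eval x ≠ 0 := by
    intro h0
    exact hroot ((Polynomial.mem_roots hpne).2 h0)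
  -- rows of the evaluated rescaled matrix are independent
  have hLI : LinearIndependent ℚ (fun r => Mp.map (Polynomial.evalRingHom x) r) := by
    apply linearIndependent_of_gram_det_ne_zero
    rw [← heval x]; exact hpx
  -- transfer through the diagonal scalings
  have hinj : Function.Injective (Mp.map (Polynomial.evalRingHom x)).vecMul := Matrix.vecMul_injective_iff.2 hLI
  apply Matrix.vecMul_injective_iff.1
  intro g₁ g₂ hg
  -- rescale the row vectors
  have key : ∀ g : R → ℚ, (fun r => g r * x ^ (φ r)) ᵥ* Mp.map (Polynomial.evalRingHom x)
      = fun k => (g ᵥ* monoMat c w x) k * (x ^ (ψ k))⁻¹ := by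
    intro g
    funext k
    simp only [Matrix.vecMul, dotProduct]
    rw [Finset.sum_mul]
    refine Finset.sum_congr rfl fun r _ => ?_
    rw [monoMat_eq_scaled c w φ ψ hpot hx0 r k]
    have hψ : x ^ (ψ k) ≠ 0 := zpow_ne_zero _ hx0
    symm
    rw [mul_assoc, mul_assoc (x ^ φ r * _), mul_inv_cancel₀ hψ, mul_one, ← mul_assoc]
  have h12 : (fun r => g₁ r * x ^ (φ r)) ᵥ* Mp.map (Polynomial.evalRingHom x)
      = (fun r => g₂ r * x ^ (φ r)) ᵥ* Mp.map (Polynomial.evalRingHom x) := by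
    rw [key g₁, key g₂]
    change g₁ ᵥ* monoMat c w x = g₂ ᵥ* monoMat c w x at hg
    simp only [hg]
  have h := hinj h12
  funext r
  have hr := congrFun h r
  have hφ : x ^ (φ r) ≠ 0 := zpow_ne_zero _ hx0
  simpa [hφ] using hr

omit [DecidableEq C] in
/-- Corollary: some `x` (indeed cofinitely many) makes the rows of the monomial family independent. [this work] -/
theorem exists_linearIndependent_monoMat (c : R → C → ℚ) (w : R → C → ℕ) (φ : R → ℤ) (ψ : C → ℤ)
    (hpot : ∀ r k, c r k ≠ 0 → φ r + ψ k ≤ (w r k : ℤ))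
    (hI : LinearIndependent ℚ (fun r => initMat c w φ ψ r)) :
    ∃ x : ℚ, LinearIndependent ℚ (fun r => monoMat c w x r) := by
  obtain ⟨s, hs⟩ := linearIndependent_monoMat_of_initMat c w φ ψ hpot hI
  obtain ⟨x, hx⟩ := Infinite.exists_notMem_finset s
  exact ⟨x, hs x hx⟩

end Tropical

/-! ### The tilt certificate `T(x)` is a monomial family -/

section Tilt

variable {β γ : Type} [DecidableEq β] [Fintype β] [DecidableEq γ] [Fintype γ]

/-- The 0/1 coefficient pattern of `T(x)` (339 sparsity on the containment relation): `1` on the five blocks `D₁→A, D₁→B, D₂→B, D₃→A, D₃→E`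
for `r ≤ c`, `0` otherwise. [this work] -/
def tiltCoef (r c : Token β γ) : ℚ :=
  if r.2.1 ⊆ c.2.1 ∧ r.2.2 ⊆ c.2.2 then
    (if (r.1 = 0 ∧ c.1 = 0) ∨ (r.1 = 1 ∧ c.1 = 1) ∨ (r.1 = 2 ∧ c.1 = 2) then (1 : ℚ)
     else if (r.1 = 0 ∧ c.1 = 1) ∨ (r.1 = 2 ∧ c.1 = 0) then 1 else 0)
  else 0

/-- The exponent pattern of `T(x)`: the distance `#(w \ v) + #(u \ d)` on the two tilted blocks `D₁→B`, `D₃→A`, and `0` elsewhere. [this work] -/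
def tiltExp (r c : Token β γ) : ℕ :=
  if (r.1 = 0 ∧ c.1 = 1) ∨ (r.1 = 2 ∧ c.1 = 0) then (c.2.1 \ r.2.1).card + (c.2.2 \ r.2.2).card else 0

omit [Fintype β] [Fintype γ] in
/-- `T(x)` entrywise equals the monomial family with coefficients `tiltCoef` and exponents `tiltExp`. [this work] -/
theorem tiltCert_eq_monoMat (x : ℚ) (r c : Token β γ) : tiltCert x r c = tiltCoef r c * x ^ (tiltExp r c) := by
  unfold tiltCert tiltCoef tiltExp
  by_cases hsub : r.2.1 ⊆ c.2.1 ∧ r.2.2 ⊆ c.2.2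
  · rw [if_pos hsub, if_pos hsub]
    by_cases hplain : (r.1 = 0 ∧ c.1 = 0) ∨ (r.1 = 1 ∧ c.1 = 1) ∨ (r.1 = 2 ∧ c.1 = 2)
    · rw [if_pos hplain, if_pos hplain]
      have hnt : ¬ ((r.1 = 0 ∧ c.1 = 1) ∨ (r.1 = 2 ∧ c.1 = 0)) := by omega
      rw [if_neg hnt, pow_zero, mul_one]
    · rw [if_neg hplain, if_neg hplain]
      by_cases htilt : (r.1 = 0 ∧ c.1 = 1) ∨ (r.1 = 2 ∧ c.1 = 0)
      · rw [if_pos htilt, if_pos htilt, if_pos htilt, one_mul]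
      · rw [if_neg htilt, if_neg htilt, zero_mul]
  · rw [if_neg hsub, if_neg hsub, zero_mul]

/-- **`TiltInitIndep`** (a DEFINITION — the q-free, "tropical" form of the tilt-certificate problem; NOT asserted): for every configuration
`(P, F)` there are integer potentials `φ` on the demand tokens and `ψ` on the supply tokens, dual-feasible for the exponents of `T(x)` on its
support, whose INITIAL 0/1 matrix has linearly independent demand rows.  Sufficient for `TiltCertIndep` (`tiltCertIndep_of_tiltInitIndep`);
census: some optimal min-cost potentials work on every configuration tested at `#β + #γ ≤ 4` (P5 g19 §4(b)); no uniform rule is known and the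
statement may even fail on rare configurations (its failure would NOT refute `TiltCertIndep`: the principle is only sufficient). OPEN. [this work] -/
@[conjecture] def TiltInitIndep : Prop :=
  ∀ (β γ : Type) [DecidableEq β] [Fintype β] [DecidableEq γ] [Fintype γ]
    (P : Finset (Finset γ)) (F : Finset β → Finset (Finset γ)),
    IsUpperSet (P : Set (Finset γ)) → (∀ x, IsUpperSet (F x : Set (Finset γ))) → Monotone F →
      ∃ (φ : ↥(dipoleDem P F) → ℤ) (ψ : ↥(dipoleSup P F) → ℤ),
        (∀ r c, tiltCoef r.1 c.1 ≠ 0 → φ r + ψ c ≤ (tiltExp r.1 c.1 : ℤ)) ∧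
        LinearIndependent ℚ (fun r : ↥(dipoleDem P F) => fun c : ↥(dipoleSup P F) =>
          initMat (fun r c => tiltCoef r.1 c.1) (fun r c => tiltExp r.1 c.1) φ ψ r c)

/-- **`TiltInitIndep → TiltCertIndep`**: a per-configuration feasible potential with independent initial rows gives a rational `x` at which
`T(x)` has independent demand rows (the tropical principle). [this work] -/
theorem tiltCertIndep_of_tiltInitIndep (h : TiltInitIndep) : TiltCertIndep := by
  unfold TiltCertIndep
  unfold TiltInitIndep at h
  intro β γ i1 i2 i3 i4 P F hP hF hFm
  obtain ⟨φ, ψ, hpot, hI⟩ := h β γ P F hP hF hFm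
  have hmain := exists_linearIndependent_monoMat (R := ↥(dipoleDem P F)) (C := ↥(dipoleSup P F))
    (fun r c => tiltCoef r.1 c.1) (fun r c => tiltExp r.1 c.1) φ ψ hpot hI
  obtain ⟨x, hx⟩ := hmain
  refine ⟨x, ?_⟩
  have hx' : LinearIndependent ℚ (fun r : ↥(dipoleDem P F) => fun c : ↥(dipoleSup P F) =>
      tiltCoef r.1 c.1 * x ^ tiltExp r.1 c.1) := hx
  have heq : (fun r : ↥(dipoleDem P F) => fun c : ↥(dipoleSup P F) => tiltCert x r.1 c.1)
      = (fun r : ↥(dipoleDem P F) => fun c : ↥(dipoleSup P F) => tiltCoef r.1 c.1 * x ^ tiltExp r.1 c.1) := by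
    funext r c
    exact tiltCert_eq_monoMat x r.1 c.1
  exact heq ▸ hx'

/-- Hence also `TiltInitIndep → TriWIneq`. [this work] -/
theorem triWIneq_of_tiltInitIndep (h : TiltInitIndep) : TriWIneq :=
  triWIneq_of_tiltCertIndep (tiltCertIndep_of_tiltInitIndep h)

end Tilt

end FiveUpSet

end Summit.CriticalPhenomena.PercolationContinuityZ3.Theorems
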